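import Mathlib
import Summits.ValiantsHypothesis.ValiantsHypothesis.Theorems.GrenetZeonTwoDimCoefficientsDefs

/-!
# Crux `GrenetZeon.TwoDimCoefficients` (stmt-ValiantsHypothesis-8062), stub `stub_dualUnipotent`:
# the direction matrix may be taken CONSTANT and square-zero (width `m ↦ 2m`)

In a unipotent dual representation `per_n = α·det A + β·tr(adj A · B)` (`A`, `B` affine `m × m`,
`det A ≡ c ≠ 0`, `DualUnipotentRepr n m`) the affine DIRECTION `B` carries no information of its
own: with the `2m × 2m` affine matrix `Q = [[A, B], [0, 1]]` (again `det Q ≡ c`) and the CONSTANT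
matrix `E = [[0, 0], [1, 0]]` (`E² = 0`, rank `m`) one has, by the block formula
`adj Q = [[adj A, −adj A · B], [0, det A · 1]]` (`adjugate_fromBlocks_zero₂₁_one`),

  `tr(adj Q · E) = − tr(adj A · B)`     (`trace_adjugate_fromBlocks_mul_corner`),

so `per_n = α·det Q − β·tr(adj Q · E)` is a unipotent dual representation of size `2m` whose
direction is the constant square-zero matrix `E` (`dualUnipotentRepr_constDir`).  Equivalently:
`per_n − αc` is `−β` times the `t`-linear coefficient of the ONE-parameter family
`t ↦ det(Q(x) + t·E)` of affine determinants of size `2m` with `det(Q(x) + 0·E) ≡ c` — the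
first jet at a constant of a unipotent determinantal family along a constant direction.  This is
the opposite normalisation to the tree's `B(0) = 0` (`dualUnipotentRepr_normalForm`,
`…DualUnipotentBaseNormalForm.lean`): there the direction is made purely linear, here purely
constant, at the price of doubling the width.  Consequence for the stub: no lower-bound argument
for `DualUnipotentBound` can feed on the affine structure (rank, row space, zero pattern) of the
direction `B` beyond a factor `2` in `m` — compare `sq_le_of_dualUnipotentRepr_rank`
(`…DualUnipotentRankTransfer.lean`), whose hypothesis "rows of `B(x)` in a fixed `r`-space" is
about the AFFINE direction and is not invariant under this move (`E` has constant row rank `m`).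

HONEST FRAMING: a WLOG / bookkeeping lemma for an open-problem-grade stub of an ASIDE item; the
stub `DualUnipotentBound` (`n² ≤ C·m`) stays open; `VP ≠ VNP` is not moved by anything here.

References: Jacobi's formula `d/dt det(Q + tE)|₀ = tr(adj Q · E)`; T. Mignon, N. Ressayre,
Int. Math. Res. Not. 2004:79 (context only).
-/

-- single-conjunct layout `Summits/ValiantsHypothesis/ValiantsHypothesis`: the duplicated namespace
-- component is mandated by the tree.
set_option linter.dupNamespace false

noncomputable section

namespace Summit.ValiantsHypothesis.ValiantsHypothesis.Cruxes.TwoDimCoefficients.DimTwoCases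

open MvPolynomial Matrix
open Literature.Computability.AlgebraicComplexity

/-! ### Block bookkeeping: adjugate of `[[A, B], [0, 1]]` -/

section Blocks

variable {R : Type*} [CommRing R] {p : Type*} [Fintype p] [DecidableEq p]

/-- Uniqueness of the adjugate when `det` is a unit: `Q · G = det Q · 1` forces `G = adj Q`.
[folklore] -/
theorem adjugate_eq_of_mul_eq_det_smul_one (Q G : Matrix p p R) (hQ : IsUnit Q.det)
    (h : Q * G = Q.det • (1 : Matrix p p R)) : Q.adjugate = G := by
  have h1 : Q.adjugate * (Q * G) = Q.det • G := by
    rw [← Matrix.mul_assoc, adjugate_mul, smul_mul_assoc, Matrix.one_mul]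
  have h2 : Q.adjugate * (Q * G) = Q.det • Q.adjugate := by
    rw [h, mul_smul_comm, Matrix.mul_one]
  exact ((IsUnit.smul_left_cancel hQ).mp (h1.symm.trans h2)).symm

variable {q : Type*} [Fintype q] [DecidableEq q]

omit [DecidableEq p] [DecidableEq q] in
/-- The trace of a block matrix is the sum of the traces of its diagonal blocks. [folklore] -/
theorem trace_fromBlocks_diag (A : Matrix p p R) (B : Matrix p q R) (C : Matrix q p R)
    (D : Matrix q q R) : (fromBlocks A B C D).trace = A.trace + D.trace := by
  simp [Matrix.trace, Fintype.sum_sum_type]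

/-- **Adjugate of `[[A, B], [0, 1]]`** for `det A` a unit:
`adj [[A, B], [0, 1]] = [[adj A, −adj A · B], [0, det A · 1]]`. [folklore] -/
theorem adjugate_fromBlocks_zero₂₁_one (A : Matrix p p R) (B : Matrix p q R) (hA : IsUnit A.det) :
    (fromBlocks A B 0 (1 : Matrix q q R)).adjugate =
      fromBlocks A.adjugate (-(A.adjugate * B)) 0 (A.det • (1 : Matrix q q R)) := by
  apply adjugate_eq_of_mul_eq_det_smul_one
  · rw [det_fromBlocks_zero₂₁, det_one, mul_one]; exact hA
  · rw [fromBlocks_multiply, det_fromBlocks_zero₂₁, det_one, mul_one, ← fromBlocks_one,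
      fromBlocks_smul, smul_zero]
    congr 1
    · rw [Matrix.mul_zero, add_zero, mul_adjugate]
    · rw [Matrix.mul_neg, ← Matrix.mul_assoc, mul_adjugate, Matrix.smul_mul, Matrix.one_mul,
        Matrix.mul_smul, Matrix.mul_one, neg_add_cancel]
    · rw [Matrix.zero_mul, Matrix.one_mul, add_zero, smul_zero]
    · rw [Matrix.zero_mul, Matrix.one_mul, zero_add]

/-- **The corner trace.** With the constant square-zero direction `E = [[0, 0], [1, 0]]`:
`tr(adj [[A, B], [0, 1]] · E) = −tr(adj A · B)`. [folklore] -/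
theorem trace_adjugate_fromBlocks_mul_corner (A B : Matrix p p R) (hA : IsUnit A.det) :
    ((fromBlocks A B 0 (1 : Matrix p p R)).adjugate * fromBlocks 0 0 (1 : Matrix p p R) 0).trace =
      -(A.adjugate * B).trace := by
  rw [adjugate_fromBlocks_zero₂₁_one A B hA, fromBlocks_multiply, trace_fromBlocks_diag]
  simp

/-- The corner direction is square-zero. [folklore] -/
theorem corner_mul_corner :
    fromBlocks (0 : Matrix p p R) (0 : Matrix p p R) (1 : Matrix p p R) (0 : Matrix p p R) *
      fromBlocks (0 : Matrix p p R) (0 : Matrix p p R) (1 : Matrix p p R) (0 : Matrix p p R) = 0 := by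
  rw [fromBlocks_multiply]
  simp

end Blocks

/-! ### The constant-direction normal form -/

variable {n m : ℕ}

/-- Entries of `[[A, B], [0, 1]]` are affine when those of `A`, `B` are. [folklore] -/
theorem isAffine_reindex_fromBlocks (A B : AffMat n m) (hA : IsAffine A) (hB : IsAffine B)
    (e : Fin m ⊕ Fin m ≃ Fin (m + m)) :
    IsAffine (n := n) (m := m + m) (reindex e e (fromBlocks A B 0 1)) := by
  intro i j
  rw [reindex_apply, submatrix_apply]
  rcases e.symm i with a | a <;> rcases e.symm j with b | b
  · simpa only [fromBlocks_apply₁₁] using hA a b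
  · simpa only [fromBlocks_apply₁₂] using hB a b
  · simp only [fromBlocks_apply₂₁, Matrix.zero_apply, totalDegree_zero]; exact Nat.zero_le _
  · simp only [fromBlocks_apply₂₂, Matrix.one_apply]
    split_ifs
    · rw [totalDegree_one]; exact Nat.zero_le _
    · rw [totalDegree_zero]; exact Nat.zero_le _

/-- **Constant square-zero direction (width `m ↦ 2m`).**  A unipotent dual representation of
`per_n` of size `m` yields one of size `m + m` whose direction matrix is a CONSTANT matrix `E`
with `E² = 0`: `per_n = α·det Q + β'·tr(adj Q · E)` with `Q = [[A, B], [0, 1]]` affine,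
`det Q ≡ c ≠ 0`, `E = [[0, 0], [1, 0]]`, `β' = −β`. [folklore] -/
theorem dualUnipotentRepr_constDir (h : DualUnipotentRepr n m) :
    ∃ (α β c : ℂ) (Q : AffMat n (m + m)) (E : Matrix (Fin (m + m)) (Fin (m + m)) ℂ),
      IsAffine Q ∧ c ≠ 0 ∧ Q.det = C c ∧ E * E = 0 ∧
      perPoly (Fin n) ℂ = C α * Q.det + C β * (Q.adjugate * E.map C).trace := by
  obtain ⟨α, β, c, A, B, hA, hB, hc, hdet, hper⟩ := h
  let e : Fin m ⊕ Fin m ≃ Fin (m + m) := finSumFinEquiv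
  have hAu : IsUnit A.det := by
    rw [hdet]; exact (isUnit_iff_ne_zero.mpr hc).map C
  -- the constant corner matrix and its polynomial image
  let E₀ : Matrix (Fin m ⊕ Fin m) (Fin m ⊕ Fin m) ℂ := fromBlocks 0 0 1 0
  have hE₀ : E₀.map (C : ℂ → MvPolynomial (Fin n × Fin n) ℂ) = fromBlocks 0 0 1 0 := by
    simp only [E₀, fromBlocks_map, Matrix.map_zero (C : ℂ → MvPolynomial (Fin n × Fin n) ℂ) C_0,
      Matrix.map_one (C : ℂ → MvPolynomial (Fin n × Fin n) ℂ) C_0 C_1]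
  refine ⟨α, -β, c, reindex e e (fromBlocks A B 0 1), reindex e e E₀,
    isAffine_reindex_fromBlocks A B hA hB e, hc, ?_, ?_, ?_⟩
  · rw [det_reindex_self, det_fromBlocks_zero₂₁, det_one, mul_one, hdet]
  · rw [reindex_apply, submatrix_mul_equiv, corner_mul_corner]; rfl
  · have hmap : (reindex e e E₀).map (C : ℂ → MvPolynomial (Fin n × Fin n) ℂ) =
        (fromBlocks 0 0 (1 : Matrix (Fin m) (Fin m) (MvPolynomial (Fin n × Fin n) ℂ)) 0).submatrix
          e.symm e.symm := by
      rw [reindex_apply, ← submatrix_map, hE₀]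
    have htr : ((((fromBlocks A B 0 1).adjugate *
        fromBlocks 0 0 (1 : Matrix (Fin m) (Fin m) (MvPolynomial (Fin n × Fin n) ℂ)) 0)).submatrix
          e.symm e.symm).trace = -(A.adjugate * B).trace := by
      rw [← trace_adjugate_fromBlocks_mul_corner A B hAu]
      simp only [Matrix.trace, diag_apply, submatrix_apply]
      exact Equiv.sum_comp e.symm (fun i => (((fromBlocks A B 0 1).adjugate *
        fromBlocks 0 0 (1 : Matrix (Fin m) (Fin m) (MvPolynomial (Fin n × Fin n) ℂ)) 0) :
          Matrix _ _ _) i i)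
    rw [hmap, adjugate_reindex, reindex_apply, reindex_apply, submatrix_mul_equiv,
      det_submatrix_equiv_self, det_fromBlocks_zero₂₁, det_one, mul_one, htr, map_neg, neg_mul_neg,
      hper]

end Summit.ValiantsHypothesis.ValiantsHypothesis.Cruxes.TwoDimCoefficients.DimTwoCases

end
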